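import Mathlib
import Summits.ValiantsHypothesis.ValiantsHypothesis.Theorems.BarrierLeverPartitionMinorsHitByVPHiddenStatesSharedQuadric

/-!
# Route BarrierLever — item `PartitionMinorsHitByVP` (stmt-ValiantsHypothesis-19717), line `hidden_states`:
# THE VERTEX-COVER LAW — a pair block on `b` states is singular on the edges of any graph with a vertex cover of fewer than `b` vertices

Helper file (`--supports stmt-ValiantsHypothesis-19717`; cell valiant-natproofs, rung V4, 𝒟-side door (c), line `hidden_states`, node #1;
prover seat val-np-p3 gen 21; memo HOME/val-np-p3/g21/MEMO-bpwindow-valnp3-g21.md §13). Definition-free beyond two explicit finite families.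
Closes NO item.

THE LAW (single table, zero base point, `PairBlock.cfgMat`). Let every row be a 2-subset of `Fin h` meeting a fixed set `B` (i.e. the rows are
edges of a graph with vertex cover `B`), and let `S ⊆ Fin K` be a state set with `|B| < |S|`. If `#{(q,q') ∈ S², q ≤ q'} + #{k : cols k ⊄ S} ≤ n`
then `det (cfgMat U cols g) = 0` FOR EVERY TABLE (`det_cfgMat_eq_zero_vertexCover`). Mechanism: some nonzero `κ` on `S` has
`V := Σ_{q∈S} κ_q g_q` vanishing on `B` (dimension count, `exists_cover_vector`); on a row `{a,c}` with `a ∈ B` the symmetrised generators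
`w_{q,q'}` (`SharedQuadric.gen`) satisfy `Σ_{q ≤ q'} m κ_qκ_{q'} w_{q,q'} = 2V(a)V(c) = 0`; rank–nullity. This is the single-block companion of
the shared-quadric law (p725561): on the pair rows `{a,c}` of a sub-cube the row of a pair block on `b` states is the symmetric product
`γ_a ⊙ γ_c` (`γ_a = (g_q(a))_q ∈ ℂ^b`), so the row matroid there is the LINEAR matroid of pairwise symmetric products of generic vectors in `ℂ^b`
(a relative of — not the same as — the symmetric determinantal matroid of Király–Rosen–Theran 2013, arXiv:1312.3777 §3.2, which is realised by
the larger tangent space), whose circuits are NOT all cones over sub-cube layers — e.g.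
**`det_cfgMat_K32_eq_zero`**: the pair block on 3 states is singular on the six edges of `K_{3,2}` inside `Fin 5` for every table (rank 5), the
exception found by the exhaustive rank census kit j332385 (10 non-cone dependent 6-sets among 942 617 families); it refutes the
«cone-laminar rank function» conjecture R″ of the memo for unsaturated pieces. WHAT THIS IS NOT: nothing on crux 14610 or VP ≠ VNP.
-/

set_option linter.dupNamespace false

namespace Summit.ValiantsHypothesis.ValiantsHypothesis.Theorems.BarrierLever.HiddenStates

open Finset Matrix

noncomputable section

namespace SharedQuadric

open PairBlock

variable {h K n : ℕ}

/-- If `|B| < |S|` some nonzero coefficient vector on `S` gives a combination of the states vanishing on `B`. -/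
theorem exists_cover_vector (g : Fin K → Fin h → ℂ) (B : Finset (Fin h)) (S : Finset (Fin K)) (hdim : B.card < S.card) :
    ∃ κ : Fin K → ℂ, (∃ q ∈ S, κ q ≠ 0) ∧ ∀ x ∈ B, ∑ q ∈ S, κ q * g q x = 0 := by
  classical
  let M : Matrix ↥B ↥S ℂ := Matrix.of fun x q => g q x
  let L : (↥S → ℂ) →ₗ[ℂ] (↥B → ℂ) := M.mulVecLin
  have hlt : Module.finrank ℂ (↥B → ℂ) < Module.finrank ℂ (↥S → ℂ) := by
    rw [Module.finrank_fintype_fun_eq_card, Module.finrank_fintype_fun_eq_card, Fintype.card_coe, Fintype.card_coe]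
    exact hdim
  have hker := LinearMap.ker_ne_bot_of_finrank_lt (f := L) hlt
  obtain ⟨c, hc, hc0⟩ := Submodule.exists_mem_ne_zero_of_ne_bot hker
  rw [LinearMap.mem_ker] at hc
  set κ : Fin K → ℂ := fun q => if hq : q ∈ S then c ⟨q, hq⟩ else 0 with hκ
  have hκc : ∀ q : ↥S, κ q = c q := fun q => by
    have hq : (q : Fin K) ∈ S := q.2
    simp only [hκ, dif_pos hq]
  refine ⟨κ, ?_, ?_⟩
  · by_contra hall
    push Not at hall
    apply hc0
    funext q
    rw [← hκc q]
    exact hall q q.2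
  · intro x hx
    have hcx : (M.mulVec c) ⟨x, hx⟩ = 0 := by
      have := congrFun hc ⟨x, hx⟩
      simpa [L] using this
    simp only [Matrix.mulVec, dotProduct, M, Matrix.of_apply] at hcx
    rw [← Finset.sum_coe_sort S]
    rw [← hcx]
    exact Finset.sum_congr rfl fun q _ => by rw [hκc q, mul_comm]

/-- The weighted upper-triangular sum of a swap-symmetric function equals the full ordered sum. -/
theorem sum_filter_le_weighted (S : Finset (Fin K)) (F : Fin K × Fin K → ℂ) (hF : ∀ p, F p.swap = F p) :
    ∑ p ∈ (S ×ˢ S).filter (fun p => p.1 ≤ p.2), (if p.1 = p.2 then (1 : ℂ) else 2) * F p = ∑ p ∈ S ×ˢ S, F p := by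
  classical
  have hsplit : S ×ˢ S = (S ×ˢ S).filter (fun p => p.1 ≤ p.2) ∪ (S ×ˢ S).filter (fun p => p.2 < p.1) := by
    ext p
    simp only [Finset.mem_union, Finset.mem_filter]
    constructor
    · intro hp; rcases le_or_gt p.1 p.2 with h1 | h1; exacts [Or.inl ⟨hp, h1⟩, Or.inr ⟨hp, h1⟩]
    · rintro (⟨hp, -⟩ | ⟨hp, -⟩) <;> exact hp
  have hdj : Disjoint ((S ×ˢ S).filter (fun p => p.1 ≤ p.2)) ((S ×ˢ S).filter (fun p => p.2 < p.1)) := by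
    rw [Finset.disjoint_filter]; intro p _ h1 h2; exact absurd h2 (not_lt.mpr h1)
  have hR : ∑ p ∈ S ×ˢ S, F p =
      ∑ p ∈ (S ×ˢ S).filter (fun p => p.1 ≤ p.2), F p + ∑ p ∈ (S ×ˢ S).filter (fun p => p.2 < p.1), F p := by
    conv_lhs => rw [hsplit]
    exact Finset.sum_union hdj
  have hlow : ∑ p ∈ (S ×ˢ S).filter (fun p => p.2 < p.1), F p =
      ∑ p ∈ (S ×ˢ S).filter (fun p => p.1 < p.2), F p := by
    refine Finset.sum_bij' (fun p _ => p.swap) (fun p _ => p.swap) ?_ ?_ ?_ ?_ ?_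
    · intro p hp
      simp only [Finset.mem_filter, Finset.mem_product] at hp ⊢
      exact ⟨⟨hp.1.2, hp.1.1⟩, hp.2⟩
    · intro p hp
      simp only [Finset.mem_filter, Finset.mem_product] at hp ⊢
      exact ⟨⟨hp.1.2, hp.1.1⟩, hp.2⟩
    · intro p _; rfl
    · intro p _; rfl
    · intro p _; exact (hF p).symm
  have hle : (S ×ˢ S).filter (fun p => p.1 ≤ p.2) =
      (S ×ˢ S).filter (fun p => p.1 = p.2) ∪ (S ×ˢ S).filter (fun p => p.1 < p.2) := by
    ext p
    simp only [Finset.mem_union, Finset.mem_filter]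
    constructor
    · intro hp; rcases lt_or_eq_of_le hp.2 with h1 | h1; exacts [Or.inr ⟨hp.1, h1⟩, Or.inl ⟨hp.1, h1⟩]
    · rintro (⟨hp, h1⟩ | ⟨hp, h1⟩); exacts [⟨hp, le_of_eq h1⟩, ⟨hp, le_of_lt h1⟩]
  have hdj2 : Disjoint ((S ×ˢ S).filter (fun p => p.1 = p.2)) ((S ×ˢ S).filter (fun p => p.1 < p.2)) := by
    rw [Finset.disjoint_filter]; intro p _ h1 h2; exact absurd h1 (ne_of_lt h2)
  have hL : ∀ G : Fin K × Fin K → ℂ, ∑ p ∈ (S ×ˢ S).filter (fun p => p.1 ≤ p.2), G p =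
      ∑ p ∈ (S ×ˢ S).filter (fun p => p.1 = p.2), G p + ∑ p ∈ (S ×ˢ S).filter (fun p => p.1 < p.2), G p := by
    intro G
    rw [hle]
    exact Finset.sum_union hdj2
  have h1 : ∑ p ∈ (S ×ˢ S).filter (fun p => p.1 = p.2), (if p.1 = p.2 then (1 : ℂ) else 2) * F p =
      ∑ p ∈ (S ×ˢ S).filter (fun p => p.1 = p.2), F p :=
    Finset.sum_congr rfl fun p hp => by rw [Finset.mem_filter] at hp; rw [if_pos hp.2, one_mul]
  have h2 : ∑ p ∈ (S ×ˢ S).filter (fun p => p.1 < p.2), (if p.1 = p.2 then (1 : ℂ) else 2) * F p =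
      ∑ p ∈ (S ×ˢ S).filter (fun p => p.1 < p.2), F p + ∑ p ∈ (S ×ˢ S).filter (fun p => p.1 < p.2), F p := by
    rw [← Finset.sum_add_distrib]
    refine Finset.sum_congr rfl fun p hp => ?_
    rw [Finset.mem_filter] at hp; rw [if_neg (ne_of_lt hp.2)]; ring
  rw [hL, h1, h2, hR, hlow, hL F]
  ring

/-- On a two-element row `{a, c}`: `Σ_x Σ_{y ≠ x} V x · V y = 0` as soon as `V a = 0` or `V c = 0`. -/
theorem sum_erase_mul_eq_zero_of_cover {U : Finset (Fin h)} (hU : U.card = 2) (V : Fin h → ℂ)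
    (hcover : ∃ x ∈ U, V x = 0) : ∑ x ∈ U, ∑ y ∈ U.erase x, V x * V y = 0 := by
  classical
  obtain ⟨a, c, hac, rfl⟩ := Finset.card_eq_two.mp hU
  rw [Finset.sum_pair hac, Finset.erase_insert (by simpa using hac), Finset.sum_singleton,
    Finset.pair_comm, Finset.erase_insert (by simpa using hac.symm), Finset.sum_singleton]
  obtain ⟨x, hx, hVx⟩ := hcover
  rw [Finset.pair_comm] at hx
  rcases Finset.mem_insert.mp hx with rfl | hx'
  · rw [hVx]; ring
  · rw [Finset.mem_singleton] at hx'
    subst hx'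
    rw [hVx]; ring

/-- **THE VERTEX-COVER LAW.** See the module docstring. -/
theorem det_cfgMat_eq_zero_vertexCover (U : Fin n → Finset (Fin h)) (cols : Fin n → Finset (Fin K))
    (g : Fin K → Fin h → ℂ) (B : Finset (Fin h)) (hU : ∀ i, (U i).card = 2 ∧ ∃ x ∈ U i, x ∈ B)
    (S : Finset (Fin K)) (hdim : B.card < S.card)
    (hcount : ((S ×ˢ S).filter fun p => p.1 ≤ p.2).card + (Finset.univ.filter fun k => ¬ cols k ⊆ S).card ≤ n) :
    (cfgMat U cols g).det = 0 := by
  classical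
  set GS := (S ×ˢ S).filter fun p => p.1 ≤ p.2 with hGS
  set Oth := Finset.univ.filter fun k : Fin n => ¬ cols k ⊆ S with hOth
  let Gen := ↥GS ⊕ ↥Oth
  let vec : Gen → (Fin n → ℂ)
    | Sum.inl p => fun i => gen g (U i) p.1
    | Sum.inr k => fun i => cfgMat U cols g i k.1
  set W : Submodule ℂ (Fin n → ℂ) := Submodule.span ℂ (Set.range vec) with hW
  have hgenS : ∀ p ∈ S ×ˢ S, (fun i => gen g (U i) p) ∈ W := by
    intro p hp
    rw [Finset.mem_product] at hp
    by_cases hle : p.1 ≤ p.2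
    · exact Submodule.subset_span ⟨Sum.inl ⟨p, by rw [hGS, Finset.mem_filter, Finset.mem_product]; exact ⟨hp, hle⟩⟩, rfl⟩
    · have hmem : p.swap ∈ GS := by
        rw [hGS, Finset.mem_filter, Finset.mem_product]
        exact ⟨⟨hp.2, hp.1⟩, le_of_lt (lt_of_not_ge hle)⟩
      have : (fun i => gen g (U i) p) = fun i => gen g (U i) p.swap := funext fun i => (gen_swap g (U i) p).symm
      rw [this]
      exact Submodule.subset_span ⟨Sum.inl ⟨p.swap, hmem⟩, rfl⟩
  have hcol : ∀ k, (fun i => cfgMat U cols g i k) ∈ W := by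
    intro k
    by_cases hS : cols k ⊆ S
    · have : (fun i => cfgMat U cols g i k) = (1 / 2 : ℂ) • ∑ p ∈ cols k ×ˢ cols k, fun i => gen g (U i) p := by
        funext i
        simp only [cfgMat, Matrix.of_apply, Pi.smul_apply, Finset.sum_apply, smul_eq_mul]
        exact prod_sum_eq_half_sum_gen g (hU i).1 (cols k)
      rw [this]
      exact Submodule.smul_mem _ _ (Submodule.sum_mem _ fun p hp =>
        hgenS p (Finset.product_subset_product hS hS hp))
    · exact Submodule.subset_span ⟨Sum.inr ⟨k, by rw [hOth, Finset.mem_filter]; exact ⟨Finset.mem_univ _, hS⟩⟩, rfl⟩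
  obtain ⟨κ, ⟨q₀, hq₀, hκ0⟩, hcov⟩ := exists_cover_vector g B S hdim
  let Φ : (Gen → ℂ) →ₗ[ℂ] (Fin n → ℂ) := Fintype.linearCombination ℂ vec
  have hrange : LinearMap.range Φ = W := by
    rw [hW, Fintype.range_linearCombination]
  let ρ : Gen → ℂ
    | Sum.inl p => (if p.1.1 = p.1.2 then 1 else 2) * (κ p.1.1 * κ p.1.2)
    | Sum.inr _ => 0
  have hΦρ : Φ ρ = 0 := by
    funext i
    simp only [Φ, Fintype.linearCombination_apply, Finset.sum_apply, Pi.smul_apply, smul_eq_mul, Pi.zero_apply]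
    rw [Fintype.sum_sum_type]
    simp only [ρ, vec, zero_mul, Finset.sum_const_zero, add_zero]
    have hSsum : ∑ p : ↥GS, (if p.1.1 = p.1.2 then (1 : ℂ) else 2) * (κ p.1.1 * κ p.1.2) * gen g (U i) p.1 =
        ∑ x ∈ U i, ∑ y ∈ (U i).erase x, (∑ q ∈ S, κ q * g q x) * (∑ q ∈ S, κ q * g q y) := by
      rw [← sum_kappa_gen, ← sum_filter_le_weighted S (fun p => κ p.1 * κ p.2 * gen g (U i) p)
        (fun p => by rw [gen_swap]; simp [mul_comm])]
      rw [← Finset.sum_coe_sort GS]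
      refine Finset.sum_congr rfl fun p _ => by ring
    rw [hSsum]
    obtain ⟨x, hxU, hxB⟩ := (hU i).2
    exact sum_erase_mul_eq_zero_of_cover (hU i).1 (fun x => ∑ q ∈ S, κ q * g q x) ⟨x, hxU, hcov x hxB⟩
  have hρ0 : ρ ≠ 0 := by
    intro h0
    have hmem : (q₀, q₀) ∈ GS := by rw [hGS, Finset.mem_filter, Finset.mem_product]; exact ⟨⟨hq₀, hq₀⟩, le_rfl⟩
    have := congrFun h0 (Sum.inl ⟨(q₀, q₀), hmem⟩)
    simp only [ρ, Pi.zero_apply, if_true, one_mul, mul_eq_zero, or_self] at this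
    exact hκ0 this
  have hker : 1 ≤ Module.finrank ℂ (LinearMap.ker Φ) := by
    rw [Submodule.one_le_finrank_iff]
    intro hbot
    have : ρ ∈ LinearMap.ker Φ := by rw [LinearMap.mem_ker]; exact hΦρ
    rw [hbot, Submodule.mem_bot] at this
    exact hρ0 this
  have hdimW : Module.finrank ℂ W + 1 ≤ Fintype.card Gen := by
    have hrn := Φ.finrank_range_add_finrank_ker
    rw [hrange, Module.finrank_fintype_fun_eq_card] at hrn
    omega
  have hcardGen : Fintype.card Gen = GS.card + Oth.card := by
    simp only [Gen, Fintype.card_sum, Fintype.card_coe]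
  by_contra hdet
  have hcols : LinearIndependent ℂ (cfgMat U cols g).col := Matrix.linearIndependent_cols_of_det_ne_zero hdet
  let c : Fin n → W := fun k => ⟨(cfgMat U cols g).col k, hcol k⟩
  have hc : LinearIndependent ℂ c := LinearIndependent.of_comp W.subtype hcols
  have hle := hc.fintype_card_le_finrank
  rw [Fintype.card_fin] at hle
  omega

/-! ## The benchmark instance: the pair block on 3 states against the six edges of `K_{3,2}` in `Fin 5` -/

/-- The six edges `{a, y}`, `a ∈ {0,1,2}`, `y ∈ {3,4}`. -/
def rowsK32 : Fin 6 → Finset (Fin 5) := ![{0, 3}, {0, 4}, {1, 3}, {1, 4}, {2, 3}, {2, 4}]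

/-- The complete pair block on 3 states: singles and pairs. -/
def colsPB3 : Fin 6 → Finset (Fin 3) := ![{0}, {1}, {2}, {0, 1}, {0, 2}, {1, 2}]

/-- **`PB(3)` is singular on `E(K_{3,2})` FOR EVERY TABLE** (vertex cover `{3,4}` of size `2 < 3`; exhaustive census kit j332385:
generic rank 5) — a dependent 6-set of the off-diagonal rank-3 symmetric completion matroid on `Fin 5` that is not a cone over a sub-cube layer. -/
theorem det_cfgMat_K32_eq_zero (g : Fin 3 → Fin 5 → ℂ) : (cfgMat rowsK32 colsPB3 g).det = 0 :=
  det_cfgMat_eq_zero_vertexCover rowsK32 colsPB3 g ({3, 4} : Finset (Fin 5)) (fun i => by fin_cases i <;> decide)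
    Finset.univ (by decide) (by decide)

end SharedQuadric

end

end Summit.ValiantsHypothesis.ValiantsHypothesis.Theorems.BarrierLever.HiddenStates
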